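import Summits.Ventures.CertifiedManyBodySolver.Downfold.EmeryAxialResolventLevel
import HarnessLib

/-!
# The exact secant identity of the axial level map and the Hellmann–Feynman splitting bracket as two-point convexity

Venture CertifiedManyBodySolver, cell `pub/hubbard-downfold` (stage S1; INFLATION-RULES-3to1-B §B.80 (e)), seat hubbard-downfold-mod-4 (technique B, g32);
namespace `Summit.Ventures.CertifiedManyBodySolver.Downfold.Emery`. Companion of `EmeryAxialResolventLevel` (§1 root identity `T·axialLin = (ε_s − ε)·minor4S`,
§3 `resolventNum` = the sum-of-squares slope numerator, `dsec4/minor4S = 1 + T·resolventNum/minor4S²` at a root). Everything PROVED (0 sorry; `ring`,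
`linear_combination`, sign bookkeeping). WHAT THIS IS NOT: a statement about any material; U = 0 one-body algebra of the `(d, s, p_x, p_y; t_pp, t_pp′)` model.

* THE EXACT SECANT IDENTITY. The divided difference of `axialLin/minor4S` is the POLARISED sum of squares
  `resolventDD ε₁ ε₂ = 16t_pd²(Δ+ε₁)(Δ+ε₂)(x−y)² + 4x(fsD1(ε₁) − 2fsN1(ε₁)y)(fsD1(ε₂) − 2fsN1(ε₂)y) + 4y(…x…)(…x…)` (the resolvent identity
  `R₂ − R₁ = (ε₂ − ε₁)R₁R₂`: `axialLin_mul_minor4S_sub`, `ring`; `resolventDD_self = resolventNum`), so two band points at the same `k`, `T` satisfy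
  **`(ℓ₂ − ℓ₁)·m₁m₂ = (ε₂ − ε₁)·(m₁m₂ + T·resolventDD ε₁ ε₂)`** (`root_split_identity`, division-free, exact): the splitting to all orders in `t⊥`. The
  Hellmann–Feynman bracket `2t⊥_ss·w_s(even state) ≤ Δε ≤ 2t⊥_ss·w_s(odd state)` is equivalent to the two-point convexity of `axialLin/minor4S` between
  the two energies (`hf_lower_iff`, `hf_upper_iff`); it holds on 845/845 sampled configurations of the physical box (float, cell file
  `bilayer-g32/explore/ex3.py`) but is not a theorem of the model (the level map is sigmoid across a band window).


Sources: [AndersenEtAl1995, Eqs. (2), (5), (24)]; [folklore] resolvent algebra (`R₂ − R₁ = (ε₂ − ε₁)R₁R₂`).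
-/

noncomputable section

namespace Summit.Ventures.CertifiedManyBodySolver.Downfold.Emery

open Real Set

/-! ## The exact secant identity; the Hellmann–Feynman bracket as two-point convexity -/

/-- The POLARISED sum of squares: `(adj(H_σ − ε₁)v)·(adj(H_σ − ε₂)v)` written in `x, y`. [folklore] -/
def resolventDD (Δ tpd tpp c x y ε₁ ε₂ : ℝ) : ℝ :=
  16 * tpd ^ 2 * (Δ + ε₁) * (Δ + ε₂) * (x - y) ^ 2
    + 4 * x * ((fsD1 Δ ε₁ - 2 * fsN1 tpd tpp c ε₁ * y) * (fsD1 Δ ε₂ - 2 * fsN1 tpd tpp c ε₂ * y))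
    + 4 * y * ((fsD1 Δ ε₁ - 2 * fsN1 tpd tpp c ε₁ * x) * (fsD1 Δ ε₂ - 2 * fsN1 tpd tpp c ε₂ * x))

/-- On the diagonal the polarised form is the sum of squares: `resolventDD ε ε = resolventNum ε`. [folklore] -/
theorem resolventDD_self (Δ tpd tpp c x y ε : ℝ) : resolventDD Δ tpd tpp c x y ε ε = resolventNum Δ tpd tpp c x y ε := by
  rw [resolventNum_sos]; unfold resolventDD; ring

/-- `resolventDD` is symmetric in the two energies. [folklore] -/
theorem resolventDD_comm (Δ tpd tpp c x y ε₁ ε₂ : ℝ) : resolventDD Δ tpd tpp c x y ε₁ ε₂ = resolventDD Δ tpd tpp c x y ε₂ ε₁ := by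
  unfold resolventDD; ring

/-- **THE RESOLVENT IDENTITY** `R₂ − R₁ = (ε₂ − ε₁)R₁R₂` in polynomial form:
`axialLin(ε₂)·minor4S(ε₁) − axialLin(ε₁)·minor4S(ε₂) = (ε₂ − ε₁)·resolventDD ε₁ ε₂`. [folklore] -/
theorem axialLin_mul_minor4S_sub (Δ tpd tpp c x y ε₁ ε₂ : ℝ) :
    axialLin Δ tpd tpp c x y ε₂ * minor4S Δ tpd tpp c x y ε₁ - axialLin Δ tpd tpp c x y ε₁ * minor4S Δ tpd tpp c x y ε₂ =
      (ε₂ - ε₁) * resolventDD Δ tpd tpp c x y ε₁ ε₂ := by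
  unfold resolventDD axialLin minor4S charCubic fsD1 fsN1
  ring

/-- **THE EXACT SPLITTING IDENTITY** (division-free, all orders in the level shift): two band points `(ε₁; ℓ₁)`, `(ε₂; ℓ₂)` at the same `k`, `T`
satisfy `(ℓ₂ − ℓ₁)·m₁m₂ = (ε₂ − ε₁)·(m₁m₂ + T·resolventDD ε₁ ε₂)`, `mᵢ = minor4S(εᵢ)`. [folklore] -/
theorem root_split_identity {Δ tpd tpp c T x y ℓ₁ ℓ₂ ε₁ ε₂ : ℝ}
    (r₁ : sec4 Δ ℓ₁ tpd tpp c T x y ε₁ = 0) (r₂ : sec4 Δ ℓ₂ tpd tpp c T x y ε₂ = 0) :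
    (ℓ₂ - ℓ₁) * (minor4S Δ tpd tpp c x y ε₁ * minor4S Δ tpd tpp c x y ε₂) =
      (ε₂ - ε₁) * (minor4S Δ tpd tpp c x y ε₁ * minor4S Δ tpd tpp c x y ε₂ + T * resolventDD Δ tpd tpp c x y ε₁ ε₂) := by
  have e₁ := T_mul_axialLin_of_root r₁
  have e₂ := T_mul_axialLin_of_root r₂
  have d := axialLin_mul_minor4S_sub Δ tpd tpp c x y ε₁ ε₂
  linear_combination minor4S Δ tpd tpp c x y ε₂ * e₁ - minor4S Δ tpd tpp c x y ε₁ * e₂ + T * d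

/-- At a root, `w_s = m²/(m² + T·resolventNum)` (`m = minor4S ≠ 0`). [folklore] -/
theorem sWeight4_of_root {Δ εs tpd tpp c T x y ε : ℝ} (h : sec4 Δ εs tpd tpp c T x y ε = 0)
    (hm : minor4S Δ tpd tpp c x y ε ≠ 0) (hden : minor4S Δ tpd tpp c x y ε ^ 2 + T * resolventNum Δ tpd tpp c x y ε ≠ 0) :
    sWeight4 Δ εs tpd tpp c T x y ε =
      minor4S Δ tpd tpp c x y ε ^ 2 / (minor4S Δ tpd tpp c x y ε ^ 2 + T * resolventNum Δ tpd tpp c x y ε) := by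
  have hd := dsec4_div_minor4S_of_root h hm
  have hd' : dsec4 Δ εs tpd tpp c T x y ε =
      (minor4S Δ tpd tpp c x y ε ^ 2 + T * resolventNum Δ tpd tpp c x y ε) / minor4S Δ tpd tpp c x y ε := by
    rw [div_eq_iff hm] at hd
    rw [hd]
    field_simp
  rw [sWeight4, hd']
  field_simp

/-- **HELLMANN–FEYNMAN LOWER BOUND ⟺ TWO-POINT CONVEXITY AT THE UPPER STATE**: for two band points `(ε₁; ℓ₁)`, `(ε₂; ℓ₂)` at the same `k`, `T > 0`
with `ε₁ < ε₂`, `m₁, m₂ > 0`, `x, y ≥ 0`: `(ℓ₂ − ℓ₁)·w_s(state 2) ≤ ε₂ − ε₁ ⟺ m₂·resolventDD ε₁ ε₂ ≤ m₁·resolventNum ε₂` (secant slope of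
`axialLin/minor4S` below its tangent slope at `ε₂`). [folklore] -/
theorem hf_lower_iff {Δ tpd tpp c T x y ℓ₁ ℓ₂ ε₁ ε₂ : ℝ} (hx : 0 ≤ x) (hy : 0 ≤ y)
    (r₁ : sec4 Δ ℓ₁ tpd tpp c T x y ε₁ = 0) (r₂ : sec4 Δ ℓ₂ tpd tpp c T x y ε₂ = 0) (hlt : ε₁ < ε₂)
    (hm₁ : 0 < minor4S Δ tpd tpp c x y ε₁) (hm₂ : 0 < minor4S Δ tpd tpp c x y ε₂) (hT : 0 < T) :
    (ℓ₂ - ℓ₁) * sWeight4 Δ ℓ₂ tpd tpp c T x y ε₂ ≤ ε₂ - ε₁ ↔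
      minor4S Δ tpd tpp c x y ε₂ * resolventDD Δ tpd tpp c x y ε₁ ε₂ ≤ minor4S Δ tpd tpp c x y ε₁ * resolventNum Δ tpd tpp c x y ε₂ := by
  have id := root_split_identity r₁ r₂
  have hN : 0 ≤ resolventNum Δ tpd tpp c x y ε₂ := resolventNum_nonneg hx hy
  have hb : 0 < minor4S Δ tpd tpp c x y ε₂ ^ 2 + T * resolventNum Δ tpd tpp c x y ε₂ := by positivity
  have key : T * (ε₂ - ε₁) * (minor4S Δ tpd tpp c x y ε₁ * resolventNum Δ tpd tpp c x y ε₂ - minor4S Δ tpd tpp c x y ε₂ * resolventDD Δ tpd tpp c x y ε₁ ε₂) =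
      minor4S Δ tpd tpp c x y ε₁ * ((ε₂ - ε₁) * (minor4S Δ tpd tpp c x y ε₂ ^ 2 + T * resolventNum Δ tpd tpp c x y ε₂) - (ℓ₂ - ℓ₁) * minor4S Δ tpd tpp c x y ε₂ ^ 2) := by
    linear_combination minor4S Δ tpd tpp c x y ε₂ * id
  have hTd : 0 < T * (ε₂ - ε₁) := mul_pos hT (by linarith)
  rw [sWeight4_of_root r₂ hm₂.ne' hb.ne', ← mul_div_assoc, div_le_iff₀ hb]
  constructor
  · intro h
    have h1 : 0 ≤ minor4S Δ tpd tpp c x y ε₁ * ((ε₂ - ε₁) * (minor4S Δ tpd tpp c x y ε₂ ^ 2 + T * resolventNum Δ tpd tpp c x y ε₂) - (ℓ₂ - ℓ₁) * minor4S Δ tpd tpp c x y ε₂ ^ 2) :=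
      mul_nonneg hm₁.le (by linarith)
    rw [← key] at h1
    have h2 := (mul_nonneg_iff_of_pos_left hTd).1 h1
    linarith
  · intro h
    have h1 : 0 ≤ T * (ε₂ - ε₁) * (minor4S Δ tpd tpp c x y ε₁ * resolventNum Δ tpd tpp c x y ε₂ - minor4S Δ tpd tpp c x y ε₂ * resolventDD Δ tpd tpp c x y ε₁ ε₂) :=
      mul_nonneg hTd.le (by linarith)
    rw [key] at h1
    have h2 := (mul_nonneg_iff_of_pos_left hm₁).1 h1
    linarith

/-- **HELLMANN–FEYNMAN UPPER BOUND ⟺ TWO-POINT CONVEXITY AT THE LOWER STATE**: same setting,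
`ε₂ − ε₁ ≤ (ℓ₂ − ℓ₁)·w_s(state 1) ⟺ m₂·resolventNum ε₁ ≤ m₁·resolventDD ε₁ ε₂` (tangent slope at `ε₁` below the secant slope). Together:
the bracket `Δℓ·w_s(upper state) ≤ Δε ≤ Δℓ·w_s(lower state)` is exactly the two-point convexity of the level map between the two energies. [folklore] -/
theorem hf_upper_iff {Δ tpd tpp c T x y ℓ₁ ℓ₂ ε₁ ε₂ : ℝ} (hx : 0 ≤ x) (hy : 0 ≤ y)
    (r₁ : sec4 Δ ℓ₁ tpd tpp c T x y ε₁ = 0) (r₂ : sec4 Δ ℓ₂ tpd tpp c T x y ε₂ = 0) (hlt : ε₁ < ε₂)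
    (hm₁ : 0 < minor4S Δ tpd tpp c x y ε₁) (hm₂ : 0 < minor4S Δ tpd tpp c x y ε₂) (hT : 0 < T) :
    ε₂ - ε₁ ≤ (ℓ₂ - ℓ₁) * sWeight4 Δ ℓ₁ tpd tpp c T x y ε₁ ↔
      minor4S Δ tpd tpp c x y ε₂ * resolventNum Δ tpd tpp c x y ε₁ ≤ minor4S Δ tpd tpp c x y ε₁ * resolventDD Δ tpd tpp c x y ε₁ ε₂ := by
  have id := root_split_identity r₁ r₂
  have hN : 0 ≤ resolventNum Δ tpd tpp c x y ε₁ := resolventNum_nonneg hx hy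
  have hb : 0 < minor4S Δ tpd tpp c x y ε₁ ^ 2 + T * resolventNum Δ tpd tpp c x y ε₁ := by positivity
  have key : T * (ε₂ - ε₁) * (minor4S Δ tpd tpp c x y ε₁ * resolventDD Δ tpd tpp c x y ε₁ ε₂ - minor4S Δ tpd tpp c x y ε₂ * resolventNum Δ tpd tpp c x y ε₁) =
      minor4S Δ tpd tpp c x y ε₂ * ((ℓ₂ - ℓ₁) * minor4S Δ tpd tpp c x y ε₁ ^ 2 - (ε₂ - ε₁) * (minor4S Δ tpd tpp c x y ε₁ ^ 2 + T * resolventNum Δ tpd tpp c x y ε₁)) := by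
    linear_combination (-minor4S Δ tpd tpp c x y ε₁) * id
  have hTd : 0 < T * (ε₂ - ε₁) := mul_pos hT (by linarith)
  rw [sWeight4_of_root r₁ hm₁.ne' hb.ne', ← mul_div_assoc, le_div_iff₀ hb]
  constructor
  · intro h
    have h1 : 0 ≤ minor4S Δ tpd tpp c x y ε₂ * ((ℓ₂ - ℓ₁) * minor4S Δ tpd tpp c x y ε₁ ^ 2 - (ε₂ - ε₁) * (minor4S Δ tpd tpp c x y ε₁ ^ 2 + T * resolventNum Δ tpd tpp c x y ε₁)) :=
      mul_nonneg hm₂.le (by linarith)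
    rw [← key] at h1
    have h2 := (mul_nonneg_iff_of_pos_left hTd).1 h1
    linarith
  · intro h
    have h1 : 0 ≤ T * (ε₂ - ε₁) * (minor4S Δ tpd tpp c x y ε₁ * resolventDD Δ tpd tpp c x y ε₁ ε₂ - minor4S Δ tpd tpp c x y ε₂ * resolventNum Δ tpd tpp c x y ε₁) :=
      mul_nonneg hTd.le (by linarith)
    rw [key] at h1
    have h2 := (mul_nonneg_iff_of_pos_left hm₂).1 h1
    linarith

end Summit.Ventures.CertifiedManyBodySolver.Downfold.Emery
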